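import Literature.NumberTheory.GaloisRepresentations.LubinTateColemanTrace
import Literature.NumberTheory.GaloisRepresentations.LubinTateColemanDerivative
import HarnessLib

/-!
# Taylor expansion of Coleman translates along the formal group, and the trace operator as a series
# in the power sums of the division points

De Shalit, *Iwasawa theory of elliptic curves with complex multiplication* (1987), Ch. I §3.12 computes
Coleman's trace operator `𝒮` on `𝐆̂_m` modulo `p` from `(𝒮h)((1+X)^p - 1) = (1/p) Σ_ζ h(ζ(1+X) - 1)`
("as a simple calculation reveals").  For the Lubin–Tate group of `f = πX + X^q` over `𝒪[F]` the
analogous computation rests on the **Taylor expansion along the formal group**: writing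
`h(F(X, Y)) = Σ_j C_j(h)(X) · Y^j` (`fgTaylor h j`, the `Y^j`-coefficient of the algebraic substitution
`h ∘ F_f`), the translate by a point `ω` is `h(X [+] ω) = Σ_j C_j(h)(X) · ω^j` and therefore
`(𝒮h) ∘ f = Σ_{ω ∈ W_f^1} h(X [+] ω) = Σ_j C_j(h) · s_j`, `s_j = Σ_{ω ∈ W_f^1} ω^j` the power sums of the
division points of level one.  Everything here is **proved**:

* `fgTaylor hA hf h j` — the Taylor coefficients `C_j(h) ∈ A⟦X⟧`;
* ★ `hasSum_fgTaylor_transl` — `h(X [+] ω) = Σ_j ι(C_j(h)) · C(ω^j)` (a convergent sum in `S⟦X⟧`);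
* ★ `hasSum_fgTaylor_colemanTrace` — **`ι((𝒮h) ∘ f) = Σ_j ι(C_j(h)) · C(s_j)`** with
  `s_j = Σ_{c ∈ 𝓀} ω_c^j ∈ 𝒪_{K_π^{n+1}}`.

(The power sums of the roots of `X^q + πX` are `s_0 = q`, `s_j = 0` for `(q-1) ∤ j`,
`s_{(q-1)m} = (q-1)(-π)^m`; so `(𝒮h) ∘ f = q·h + (q-1) Σ_{m ≥ 1} (-π)^m C_{(q-1)m}(h)` and
`(π⁻¹𝒮h) ∘ f ≡ (q/π) h + C_{q-1}(h) (mod π)` — the `f`-analogue of de Shalit's monomial formulas; the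
power-sum evaluation is left to a sequel.)

## References

* E. de Shalit, *Iwasawa theory of elliptic curves with complex multiplication* (1987), Ch. I §3.12
  (proof of the Lemma). [deShalit1987]
* R. Coleman, *Division values in local fields*, Invent. Math. 53 (1979). [Coleman1979]

## Tree / Mathlib reuse

`LubinTateColeman.lean` (`transl`, `tPt`, `evalAt`, `serX`, `serC`, `aeval_subst`), `LubinTateColemanTrace.lean`
(`colemanTrace`, `map_subst_colemanTrace`, `nSum`), `LubinTate.lean` (`ltF`); Mathlib `MvPowerSeries.hasSum_aeval`,
`HasSum.prod_fiberwise`, `Equiv.hasSum_iff`, `PowerSeries.hasSum_of_monomials_self`, `hasSum_sum`.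
-/

noncomputable section

open Filter Topology
open scoped PowerSeries.WithPiTopology

namespace Literature.NumberTheory.GaloisRepresentations

namespace LubinTate

/-! ### Taylor coefficients along the formal group -/

section Taylor

variable {A : Type*} [CommRing A] {π : A} {q : ℕ} (hA : IsLTRing π q) {f : PowerSeries A}
  (hf : IsLTSeries π q f)

/-- **The Taylor coefficients of `h` along `F_f`**: `h(F(X, Y)) = Σ_j (fgTaylor h j)(X) · Y^j`, i.e.
`fgTaylor h j = Σ_i [X^i Y^j](h ∘ F_f) · X^i` (`C_0 = h`, `C_1 = D h` the invariant derivative, …).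
[cite: deShalit1987, Ch. I §3.12] -/
def fgTaylor (h : PowerSeries A) (j : ℕ) : PowerSeries A :=
  PowerSeries.mk fun i =>
    MvPowerSeries.coeff (Finsupp.single 0 i + Finsupp.single 1 j) (PowerSeries.subst (ltF hA hf) h)

/-- Coefficients of `fgTaylor` (unfolding). [cite: deShalit1987, Ch. I §3.12] -/
theorem coeff_fgTaylor (h : PowerSeries A) (j i : ℕ) :
    PowerSeries.coeff i (fgTaylor hA hf h j) =
      MvPowerSeries.coeff (Finsupp.single 0 i + Finsupp.single 1 j) (PowerSeries.subst (ltF hA hf) h) := by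
  rw [fgTaylor, PowerSeries.coeff_mk]

/-- The re-indexing `(j, i) ↦ X^i Y^j` of the exponents of `A⟦X, Y⟧`. [cite: deShalit1987, Ch. I §3.12] -/
def expEquiv : ℕ × ℕ ≃ (Fin 2 →₀ ℕ) where
  toFun ji := Finsupp.single 0 ji.2 + Finsupp.single 1 ji.1
  invFun d := (d 1, d 0)
  left_inv ji := by
    ext <;> simp
  right_inv d := by
    ext k
    fin_cases k <;> simp

omit hA hf in
/-- Values of `expEquiv`. [cite: deShalit1987, Ch. I §3.12] -/
theorem expEquiv_apply_zero (ji : ℕ × ℕ) : expEquiv ji 0 = ji.2 := by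
  simp [expEquiv]

omit hA hf in
/-- Values of `expEquiv`. [cite: deShalit1987, Ch. I §3.12] -/
theorem expEquiv_apply_one (ji : ℕ × ℕ) : expEquiv ji 1 = ji.1 := by
  simp [expEquiv]


/-- Setting `Y = 0`: the coefficient of `X^i` in `G(X, 0)` is the `X^i Y^0`-coefficient of `G`.
[cite: deShalit1987, Ch. I §3.12] -/
theorem coeff_subst_X_zero (G : MvPowerSeries (Fin 2) A) (i : ℕ) :
    PowerSeries.coeff i (MvPowerSeries.subst ![(PowerSeries.X : PowerSeries A), 0] G) =
      MvPowerSeries.coeff (Finsupp.single 0 i) G := by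
  classical
  have hX0 : MvPowerSeries.HasSubst ![(PowerSeries.X : PowerSeries A), 0] := MvPowerSeries.HasSubst.X_zero
  rw [PowerSeries.coeff, MvPowerSeries.coeff_subst hX0, finsum_eq_single _ (Finsupp.single 0 i)]
  · rw [Finsupp.prod_single_index (by simp), Matrix.cons_val_zero, smul_eq_mul]
    change MvPowerSeries.coeff (Finsupp.single 0 i) G * PowerSeries.coeff i (PowerSeries.X ^ i) = _
    rw [PowerSeries.coeff_X_pow_self, mul_one]
  · intro d hd
    rw [Finsupp.prod_fintype _ _ (fun k => pow_zero _), Fin.prod_univ_two, Matrix.cons_val_zero,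
      Matrix.cons_val_one, Matrix.cons_val_fin_one]
    by_cases hd1 : d 1 = 0
    · have hd0 : d 0 ≠ i := by
        intro h0
        refine hd (Finsupp.ext fun k => ?_)
        fin_cases k
        · simpa using h0
        · simpa using hd1
      rw [hd1, pow_zero, mul_one, smul_eq_mul]
      change MvPowerSeries.coeff d G * PowerSeries.coeff i (PowerSeries.X ^ (d 0)) = 0
      rw [PowerSeries.coeff_X_pow, if_neg (Ne.symm hd0), mul_zero]
    · rw [zero_pow hd1, mul_zero, map_zero, smul_zero]

/-- ★ **`C_0(h) = h`** (`F(X, 0) = X`). [cite: deShalit1987, Ch. I §3.12] -/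
theorem fgTaylor_zero (h : PowerSeries A) : fgTaylor hA hf h 0 = h := by
  have hX0 : MvPowerSeries.HasSubst ![(PowerSeries.X : PowerSeries A), 0] := MvPowerSeries.HasSubst.X_zero
  have hF : PowerSeries.HasSubst (ltF hA hf) :=
    PowerSeries.HasSubst.of_constantCoeff_zero (constantCoeff_ltF hA hf)
  have hXz : MvPowerSeries.subst ![(PowerSeries.X : PowerSeries A), 0] (ltF hA hf) = PowerSeries.X :=
    (formalGroup hA hf).Xzero_eq_X
  have key : MvPowerSeries.subst ![(PowerSeries.X : PowerSeries A), 0] (PowerSeries.subst (ltF hA hf) h) = h := by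
    rw [PowerSeries.subst_def, MvPowerSeries.subst_comp_subst_apply (PowerSeries.HasSubst.const hF) hX0]
    simp only [hXz]
    rw [← PowerSeries.subst_def, PowerSeries.X_subst]
  ext i
  rw [coeff_fgTaylor, Finsupp.single_zero, add_zero, ← coeff_subst_X_zero, key]

end Taylor

/-! ### The Taylor expansion of a translate `h(X [+] ω)` -/

section Points

variable {A : Type*} [CommRing A] [UniformSpace A] [DiscreteUniformity A]
variable {S : Type*} [CommRing S] [UniformSpace S] [IsUniformAddGroup S] [IsTopologicalRing S]
  [IsLinearTopology S S] [T2Space S] [CompleteSpace S] [Algebra A S] [ContinuousSMul A S]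
variable (M : NilIdeal S) {π : A} {q : ℕ} (hA : IsLTRing π q) {f : PowerSeries A}
  (hf : IsLTSeries π q f)

omit [UniformSpace A] [DiscreteUniformity A] [UniformSpace S] [IsUniformAddGroup S] [IsTopologicalRing S]
  [IsLinearTopology S S] [T2Space S] [CompleteSpace S] [ContinuousSMul A S] in
/-- `C a * X^n = monomial n a`. [cite: deShalit1987, Ch. I §3.12] -/
theorem C_mul_X_pow_eq_monomial (a : S) (n : ℕ) :
    PowerSeries.C a * PowerSeries.X ^ n = PowerSeries.monomial n a := by
  rw [← PowerSeries.monomial_zero_eq_C_apply, PowerSeries.X_pow_eq, PowerSeries.monomial_mul_monomial,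
    zero_add, mul_one]

/-- The two-variable evaluation of `h ∘ F_f` at `(X, C ω)` is the translate `h(X [+] ω)`.
[cite: deShalit1987, Ch. I §3.12] -/
theorem aeval_subst_ltF_eq_transl (ω : M.toIdeal) (h : PowerSeries A) :
    MvPowerSeries.aeval ((seriesNilIdeal M).hasEval ![serX M, serC M ω]) (PowerSeries.subst (ltF hA hf) h) =
      transl M hA hf ω h := by
  rw [transl, evalAt_apply, PowerSeries.aeval, PowerSeries.subst_def]
  refine aeval_subst (PowerSeries.HasSubst.const
    (PowerSeries.HasSubst.of_constantCoeff_zero (constantCoeff_ltF hA hf))) _ h _ fun _ => ?_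
  rfl

/-- ★ **Taylor expansion of a translate**: `h(X [+] ω) = Σ_j ι(C_j(h)) · C(ω^j)` in `S⟦X⟧`, for every
point `ω`, the sum converging in the product topology. [cite: deShalit1987, Ch. I §3.12] -/
theorem hasSum_fgTaylor_transl (ω : M.toIdeal) (h : PowerSeries A) :
    HasSum (fun j : ℕ => (fgTaylor hA hf h j).map (algebraMap A S) * PowerSeries.C ((ω : S) ^ j))
      (transl M hA hf ω h) := by
  classical
  set G := PowerSeries.subst (ltF hA hf) h with hG
  have hsum := MvPowerSeries.hasSum_aeval ((seriesNilIdeal M).hasEval ![serX M, serC M ω]) G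
  rw [aeval_subst_ltF_eq_transl M hA hf ω h] at hsum
  -- the terms: `G_d • X^{d 0} (C ω)^{d 1}`
  have hterm : ∀ d : Fin 2 →₀ ℕ,
      (MvPowerSeries.coeff d G • d.prod fun s e =>
        (((![serX M, serC M ω] s : (seriesNilIdeal M).toIdeal) : PowerSeries S)) ^ e) =
      PowerSeries.monomial (d 0) (algebraMap A S (MvPowerSeries.coeff d G)) * PowerSeries.C ((ω : S) ^ (d 1)) := by
    intro d
    rw [Finsupp.prod_fintype _ _ (fun i => pow_zero _), Fin.prod_univ_two, Matrix.cons_val_zero,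
      Matrix.cons_val_one, Matrix.cons_val_fin_one, coe_serX, coe_serC, ← map_pow,
      PowerSeries.algebra_smul_eq_C_mul, ← mul_assoc, C_mul_X_pow_eq_monomial]
  simp_rw [hterm] at hsum
  -- re-index by `(j, i)` and sum fiberwise over `j`
  have h2 := (expEquiv.hasSum_iff (f := fun d : Fin 2 →₀ ℕ =>
    PowerSeries.monomial (d 0) (algebraMap A S (MvPowerSeries.coeff d G)) * PowerSeries.C ((ω : S) ^ (d 1)))).mpr hsum
  refine h2.prod_fiberwise fun j => ?_
  -- the fibre over `j`: `Σ_i monomial i (ι G_{i,j}) · C(ω^j) = ι(C_j(h)) · C(ω^j)`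
  have h3 := (PowerSeries.hasSum_of_monomials_self
    ((fgTaylor hA hf h j).map (algebraMap A S))).mul_right (PowerSeries.C ((ω : S) ^ j))
  have e : (fun c : ℕ => ((fun d : Fin 2 →₀ ℕ =>
      PowerSeries.monomial (d 0) (algebraMap A S (MvPowerSeries.coeff d G)) * PowerSeries.C ((ω : S) ^ (d 1))) ∘
        ⇑expEquiv) (j, c)) =
      fun i => PowerSeries.monomial i (PowerSeries.coeff i ((fgTaylor hA hf h j).map (algebraMap A S))) *
        PowerSeries.C ((ω : S) ^ j) := by
    funext i
    simp only [Function.comp_apply, expEquiv_apply_zero, expEquiv_apply_one, PowerSeries.coeff_map,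
      coeff_fgTaylor]
    rfl
  rw [e]
  exact h3

end Points


/-! ### The trace operator as a series in the power sums of the division points -/

section LocalFieldTE

open GaloisRepresentations.IsNonarchimedeanLocalField ValuativeRel

variable (F : Type*) [Field F] [ValuativeRel F] [TopologicalSpace F] [IsNonarchimedeanLocalField F]

attribute [local instance] ltNormUniformSpace ltNormIsUniformAddGroup rk1 nF nE fintypeResidueField

variable {F}
variable {π : 𝒪[F]} (hπ : (valuation F).IsUniformizer (π : F)) (n : ℕ)

/-- **The power sums `s_j = Σ_{c ∈ 𝓀_F} ω_c^j ∈ 𝒪_{K_π^{n+1}}`** of the division points `W_f^1 = {ω_c}` of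
level one (the roots of `f = πX + X^q`). [cite: deShalit1987, Ch. I §3.12] -/
def divPtPowerSum (j : ℕ) : unitBall (ltField π n) :=
  ∑ c : 𝓀[F], ((ltDivPt hπ n c : (maxNilIdeal F (ltField π n)).toIdeal) : unitBall (ltField π n)) ^ j

/-- ★★ **The trace operator through the Taylor coefficients**: in `𝒪_{K_π^{n+1}}⟦X⟧`,
`ι((𝒮h) ∘ f) = Σ_j ι(C_j(h)) · C(s_j)` with `s_j` the power sums of the division points of level one
(from `(𝒮h) ∘ f = Σ_c h(X [+] ω_c)` and the Taylor expansion of each translate).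
[cite: deShalit1987, Ch. I §3.12] -/
theorem hasSum_fgTaylor_colemanTrace (h : PowerSeries (LTCoeff F)) :
    HasSum (fun j : ℕ => (fgTaylor (isLTRing_LTCoeff hπ) (isLTSeries_LTCoeff π) h j).map
        (algebraMap (LTCoeff F) (unitBall (ltField π n))) * PowerSeries.C (divPtPowerSum hπ n j))
      (PowerSeries.map (algebraMap (LTCoeff F) (unitBall (ltField π n)))
        (PowerSeries.subst (ltSer F π) (colemanTrace hπ n h))) := by
  rw [map_subst_colemanTrace, nSum]
  have e : (fun j : ℕ => (fgTaylor (isLTRing_LTCoeff hπ) (isLTSeries_LTCoeff π) h j).map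
        (algebraMap (LTCoeff F) (unitBall (ltField π n))) * PowerSeries.C (divPtPowerSum hπ n j)) =
      fun j => ∑ c : 𝓀[F], (fgTaylor (isLTRing_LTCoeff hπ) (isLTSeries_LTCoeff π) h j).map
        (algebraMap (LTCoeff F) (unitBall (ltField π n))) *
          PowerSeries.C (((ltDivPt hπ n c : (maxNilIdeal F (ltField π n)).toIdeal) :
            unitBall (ltField π n)) ^ j) := by
    funext j
    rw [divPtPowerSum, map_sum, Finset.mul_sum]
  rw [e]
  exact hasSum_sum fun c _ =>
    hasSum_fgTaylor_transl (maxNilIdeal F (ltField π n)) (isLTRing_LTCoeff hπ) (isLTSeries_LTCoeff π)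
      (ltDivPt hπ n c) h

/-! ### The power sums of `W_f^1` -/

/-- `s_0 = q`. [cite: deShalit1987, Ch. I §3.12] -/
theorem divPtPowerSum_zero : divPtPowerSum hπ n 0 = (residueFieldCard F : unitBall (ltField π n)) := by
  rw [divPtPowerSum]
  simp_rw [pow_zero]
  rw [Finset.sum_const, Finset.card_univ, nsmul_eq_mul, mul_one, residueFieldCard, Nat.card_eq_fintype_card]

/-- Each division point satisfies `ω^q = -π ω` (`f(ω) = 0`). [cite: deShalit1987, Ch. I §3.12] -/
theorem ltDivPt_pow_residueFieldCard (c : 𝓀[F]) :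
    ((ltDivPt hπ n c : (maxNilIdeal F (ltField π n)).toIdeal) : unitBall (ltField π n)) ^ residueFieldCard F =
      -(algebraMap 𝒪[F] (unitBall (ltField π n)) π *
        ((ltDivPt hπ n c : (maxNilIdeal F (ltField π n)).toIdeal) : unitBall (ltField π n))) := by
  have h := eval_ltDivPt_map_ltPoly hπ n c
  rw [ltPoly, Polynomial.map_add, Polynomial.map_mul, Polynomial.map_pow, Polynomial.map_C, Polynomial.map_X,
    Polynomial.eval_add, Polynomial.eval_mul, Polynomial.eval_C, Polynomial.eval_pow, Polynomial.eval_X] at h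
  exact eq_neg_of_add_eq_zero_right h

/-- **The recursion `s_{j+q} = -π · s_{j+1}`** (from `ω^q = -πω`). [cite: deShalit1987, Ch. I §3.12] -/
theorem divPtPowerSum_add_residueFieldCard (j : ℕ) :
    divPtPowerSum hπ n (j + residueFieldCard F) =
      -(algebraMap 𝒪[F] (unitBall (ltField π n)) π * divPtPowerSum hπ n (j + 1)) := by
  rw [divPtPowerSum, divPtPowerSum, Finset.mul_sum, ← Finset.sum_neg_distrib]
  refine Finset.sum_congr rfl fun c _ => ?_
  rw [pow_add, ltDivPt_pow_residueFieldCard, pow_succ]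
  ring

/-- **`s_1 = Σ_c ω_c` is `-π` if `q = 2` and `0` if `q > 2`** (Vieta for `∏_c (X - ω_c) = X^q + πX`).
[cite: deShalit1987, Ch. I §3.12] -/
theorem divPtPowerSum_one :
    divPtPowerSum hπ n 1 =
      if residueFieldCard F = 2 then -(algebraMap 𝒪[F] (unitBall (ltField π n)) π) else 0 := by
  set S := unitBall (ltField π n)
  have hq : 2 ≤ residueFieldCard F := one_lt_residueFieldCard F
  have hprod := map_ltPoly_eq_prod hπ n
  have hnext := Polynomial.prod_X_sub_C_nextCoeff (s := (Finset.univ : Finset 𝓀[F]))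
    (fun c => ((ltDivPt hπ n c : (maxNilIdeal F (ltField π n)).toIdeal) : S))
  rw [← hprod] at hnext
  have hs : divPtPowerSum hπ n 1 = -Polynomial.nextCoeff ((ltPoly F π).map (algebraMap 𝒪[F] S)) := by
    rw [hnext, neg_neg, divPtPowerSum]
    simp_rw [pow_one]
  -- `nextCoeff (X^q + πX) = [q = 2] π`
  have hP : (ltPoly F π).map (algebraMap 𝒪[F] S) =
      Polynomial.X ^ residueFieldCard F + Polynomial.C (algebraMap 𝒪[F] S π) * Polynomial.X := by
    rw [ltPoly, Polynomial.map_add, Polynomial.map_mul, Polynomial.map_pow, Polynomial.map_C, Polynomial.map_X,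
      add_comm]
  have hdeg : ((ltPoly F π).map (algebraMap 𝒪[F] S)).natDegree = residueFieldCard F := by
    rw [hP]
    refine (Polynomial.natDegree_add_eq_left_of_natDegree_lt ?_).trans (Polynomial.natDegree_X_pow _)
    rw [Polynomial.natDegree_X_pow]
    exact lt_of_le_of_lt ((Polynomial.natDegree_C_mul_le _ _).trans Polynomial.natDegree_X_le) hq
  rw [hs, Polynomial.nextCoeff_of_natDegree_pos (by rw [hdeg]; omega), hdeg, hP, Polynomial.coeff_add,
    Polynomial.coeff_X_pow, if_neg (by omega), zero_add, Polynomial.coeff_C_mul_X]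
  by_cases h2 : residueFieldCard F = 2
  · rw [if_pos h2, if_pos (by omega)]
  · rw [if_neg h2, if_neg (by omega), neg_zero]

/-- ★ **At `q = 2`** (e.g. `F = ℚ₂`): the power sums are `s_0 = 2`, `s_{m+1} = (-π)^{m+1}` — so
`(𝒮h) ∘ f = 2h + Σ_{j ≥ 1} (-π)^j C_j(h) = 2·C_0(h) - π·C_1(h) + π²·C_2(h) - ⋯`.
[cite: deShalit1987, Ch. I §3.12] -/
theorem divPtPowerSum_succ_of_residueFieldCard_eq_two (hq : residueFieldCard F = 2) (m : ℕ) :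
    divPtPowerSum hπ n (m + 1) = (-(algebraMap 𝒪[F] (unitBall (ltField π n)) π)) ^ (m + 1) := by
  induction m with
  | zero => rw [zero_add, pow_one, divPtPowerSum_one, if_pos hq]
  | succ m ih =>
    have h := divPtPowerSum_add_residueFieldCard hπ n m
    rw [hq] at h
    rw [h, ih, pow_succ]
    ring

end LocalFieldTE

end LubinTate

end Literature.NumberTheory.GaloisRepresentations
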